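import Mathlib
import HarnessLib
import Summits.Ventures.LatticeQCDFlow.Exactness.U1ExactForceWork
import Summits.Ventures.LatticeQCDFlow.Exactness.U1MultiStepLeapfrogHMC

/-!
# `U(1)` rung — THE ENERGY ERROR OF ONE LEAPFROG STEP OF THE FT-HMC KERNEL AS RUN IS SECOND ORDER, WITH EXPLICIT CONSTANTS: for the consistent half kick `g = −D/(4κ)` (kinetic term `κΣp²`, drift `e^{iεp}`, `D_e(V) = ∂/∂θ_e S(e^{iεθ}·V)|₀`), `|ΔH| ≤ K·‖p₁‖_∞·|ε|·(Σ_e|p₁,e| + |E|·D_max/(8κ))` with `p₁ = p + g(q)` — the «acceptance vs step size» law of the row, typed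

HONEST FRAMING: exact (Metropolis-corrected) sampling algorithms for lattice gauge theory;
figures of merit are autocorrelation/cost numbers at stated couplings and volumes; no
continuum-physics claim.

Venture `LatticeQCDFlow` (cell pub-lqcd), topic `Exactness`; FANOUT row 14 (`eng-flowhmc`, engine
`latflow.fthmc`, family B, `U(1)` rung; the reported kernel `u1LeapfrogHMCN ε κ g S n`: refresh
`p ∼ e^{−κΣp²}`, `n` P-first leapfrog steps `palindromicWord [kick g] (drift (mulDrift (u1ExpDrift ε)))` =
kick–drift–kick, flip, Metropolis on `H = S + κΣp²`).  NEW WORK of the cell over the tree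
(`U1ExactForceWork`: the work identity, the sup-metric drift bound `dist_u1Drift_le` and the first-order
Taylor bound `abs_action_u1Drift_sub_linear_le`; `SplittingIntegrator`: `kick`, `drift`, `mulDrift`,
`palindromicWord`; `U1LeapfrogHMC`: `u1ExpDrift`, `u1Kinetic`); nothing is cited as a fact; no number.  The
action `S : GaugeConfig d L U(1) → ℝ` is ARBITRARY (the FT action `β S_W∘F − log J` of any member) — only two
properties of its angular derivative `D_e(V) = fderiv (θ ↦ S(e^{iεθ}·V)) 0 (δ_e)` enter: a bound
`|D| ≤ D_max` and a Lipschitz constant `K` in the sup metric (both EXPLICIT and volume-free for the LO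
member, `U1WilsonFlowLOExactForceLipschitz`; the drift's factor `ε` sits inside `D`, so `D_max`, `K` are
`O(ε)`).

* **`u1LeapfrogStep_apply`** — the engine's step, read off: `(q, p) ↦ (e^{iεp₁}·q, p₁ + g(e^{iεp₁}·q))`,
  `p₁ = p + g(q)`;
* **`u1Leapfrog_energy_identity`** — for the CONSISTENT increment `g = −D/(4κ)` the energy change over
  one step is EXACTLY `½Σ_e p₁,e (D_e(q) − D_e(q')) + [S(q') − S(q) − Σ_e D_e(q) p₁,e] + κΣ_e (g_e(q')² − g_e(q)²)`
  — the first-order terms cancel (this is what «consistent» means: `κ = ½`, `g = −½·∂S` is the textbook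
  half kick);
* **`abs_u1Leapfrog_energy_error_le`** — hence
  `|H(q', p') − H(q, p)| ≤ K·‖p₁‖_∞·|ε|·(Σ_e |p₁,e| + |E|·D_max/(8κ))`: SECOND ORDER in the step size
  (`K ~ ε`), linear in the number of links — the typed form of the row's «acceptance vs step size» test
  (the Metropolis acceptance probability of the proposal is `≥ e^{−|ΔH|}`), every constant explicit.

* §3 **`u1LeapfrogStep_iterate_snd_le`** (momentum growth: after `k` steps `‖p_k‖ ≤ ‖p‖ + 2k·D_max/(4κ)`,
  `Σ|p_k| ≤ Σ|p| + 2k|E|·D_max/(4κ)`), **`abs_u1LeapfrogN_energy_error_le`** (the `n`-step trajectory) and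
  **`abs_u1LeapfrogProposalN_energy_error_le`** — THE ENERGY ERROR OF THE ENGINE'S PROPOSAL
  `u1LeapfrogProposalN ε g n = flip ∘ (kick–drift–kick)ⁿ`, i.e. the quantity in the Metropolis test of
  `u1LeapfrogHMCN`: `≤ n·K·|ε|·(‖p‖ + (2n+1)D_max/(4κ))·(Σ|p_e| + (2n+1)|E|D_max/(4κ) + |E|D_max/(8κ))`
  — `O(nε²) = O(τε)` at fixed trajectory length; acceptance `≥ exp(−that)` pointwise.

NOT CLAIMED: the mean acceptance under the Gibbs law (a Gaussian moment of `Σ|p|`);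
optimal constants; `SU(2)` (needs the matrix-norm drift bound); floating point; any number.
-/

noncomputable section

namespace Summit.Ventures.LatticeQCDFlow.Exactness

open Set MeasureTheory
open Literature.MathematicalPhysics.QuantumFieldTheory Literature.MathematicalPhysics.QuantumLattice

variable {d L : ℕ}

/-! ## §1 The engine's leapfrog step, read off -/

/-- **The step `palindromicWord [kick g] (drift (mulDrift (u1ExpDrift ε)))` is kick–drift–kick**:
`(q, p) ↦ (e^{iεp₁}·q, p₁ + g(e^{iεp₁}·q))` with `p₁ = p + g(q)`. -/
theorem u1LeapfrogStep_apply (g : GaugeConfig d L Circle → Edge d L → ℝ) (ε : ℝ)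
    (q : GaugeConfig d L Circle) (p : Edge d L → ℝ) :
    palindromicWord [kick g] (drift (mulDrift (u1ExpDrift ε))) (q, p) =
      ((fun i : Edge d L => Circle.exp (ε * (p + g q) i)) * q,
        (p + g q) + g ((fun i : Edge d L => Circle.exp (ε * (p + g q) i)) * q)) := by
  simp only [palindromicWord, List.prod_cons, List.prod_nil, mul_one, List.reverse_singleton,
    Equiv.Perm.mul_apply]
  rfl

/-! ## §2 The energy identity and the second-order bound -/

section Energy

variable [NeZero L]

/-- **THE ENERGY IDENTITY FOR THE CONSISTENT HALF KICK `g = −D/(4κ)`**: with `p₁ = p + g(q)`,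
`q' = e^{iεp₁}·q`, `p' = p₁ + g(q')` and `H = S + κΣp²`,
`H(q',p') − H(q,p) = ½Σ p₁(D(q) − D(q')) + [S(q') − S(q) − Σ D(q) p₁] + κΣ(g(q')² − g(q)²)`. -/
theorem u1Leapfrog_energy_identity (S : GaugeConfig d L Circle → ℝ) (ε κ : ℝ) (hκ : κ ≠ 0)
    (q : GaugeConfig d L Circle) (p : Edge d L → ℝ) :
    let D : GaugeConfig d L Circle → Edge d L → ℝ := fun W e =>
      fderiv ℝ (fun θ : (Edge d L → ℝ) => S ((fun i : Edge d L => Circle.exp (ε * θ i)) * W)) 0 (Pi.single e 1)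
    let g : GaugeConfig d L Circle → Edge d L → ℝ := fun W e => -(1 / (4 * κ)) * D W e
    let p₁ : Edge d L → ℝ := p + g q
    let q' : GaugeConfig d L Circle := (fun i : Edge d L => Circle.exp (ε * p₁ i)) * q
    (S q' + u1Kinetic κ (p₁ + g q')) - (S q + u1Kinetic κ p) =
      (1 / 2) * ∑ e, p₁ e * (D q e - D q' e) + (S q' - S q - ∑ e, D q e * p₁ e) +
        κ * ∑ e, ((g q' e) ^ 2 - (g q e) ^ 2) := by
  intro D g p₁ q'
  have hp : p = p₁ - g q := by simp [p₁]
  simp only [u1Kinetic, Real.norm_eq_abs, sq_abs]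
  rw [hp]
  simp only [Pi.add_apply, Pi.sub_apply]
  have hg : ∀ W e, g W e = -(1 / (4 * κ)) * D W e := fun W e => rfl
  have key : ∀ e, κ * ((p₁ e + g q' e) ^ 2 - (p₁ e - g q e) ^ 2) =
      (1 / 2) * (p₁ e * (D q e - D q' e)) - D q e * p₁ e + κ * ((g q' e) ^ 2 - (g q e) ^ 2) := by
    intro e
    rw [hg, hg]
    field_simp
    ring
  have hsum : κ * ∑ e, ((p₁ e + g q' e) ^ 2 - (p₁ e - g q e) ^ 2) =
      (1 / 2) * ∑ e, p₁ e * (D q e - D q' e) - ∑ e, D q e * p₁ e + κ * ∑ e, ((g q' e) ^ 2 - (g q e) ^ 2) := by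
    rw [Finset.mul_sum, Finset.mul_sum, Finset.mul_sum, ← Finset.sum_sub_distrib, ← Finset.sum_add_distrib]
    exact Finset.sum_congr rfl fun e _ => key e
  have hsplit : κ * ∑ e, (p₁ e + g q' e) ^ 2 - κ * ∑ e, (p₁ e - g q e) ^ 2 =
      κ * ∑ e, ((p₁ e + g q' e) ^ 2 - (p₁ e - g q e) ^ 2) := by
    rw [Finset.sum_sub_distrib, mul_sub]
  linarith [hsum, hsplit]

/-- **THE ENERGY ERROR OF ONE LEAPFROG STEP IS SECOND ORDER, EXPLICITLY**: if `θ ↦ S(e^{iεθ}·W)` is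
differentiable at `0` for every `W`, `|D| ≤ D_max` and `D` is `K`-Lipschitz in the sup metric, then for
the consistent half kick `g = −D/(4κ)` (`κ > 0`):
`|H(q',p') − H(q,p)| ≤ K·‖p₁‖·|ε|·(Σ_e|p₁,e| + |E|·D_max/(8κ))`. -/
theorem abs_u1Leapfrog_energy_error_le (S : GaugeConfig d L Circle → ℝ) (ε κ : ℝ) (hκ : 0 < κ)
    (hd : ∀ W : GaugeConfig d L Circle, DifferentiableAt ℝ (fun θ : (Edge d L → ℝ) => S ((fun i : Edge d L => Circle.exp (ε * θ i)) * W)) 0)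
    {Dmax K : ℝ} (hD0 : 0 ≤ Dmax) (hK0 : 0 ≤ K)
    (hDb : ∀ (W : GaugeConfig d L Circle) (e : Edge d L),
      |fderiv ℝ (fun θ : (Edge d L → ℝ) => S ((fun i : Edge d L => Circle.exp (ε * θ i)) * W)) 0 (Pi.single e 1)| ≤ Dmax)
    (hDK : ∀ (W W' : GaugeConfig d L Circle) (e : Edge d L),
      |fderiv ℝ (fun θ : (Edge d L → ℝ) => S ((fun i : Edge d L => Circle.exp (ε * θ i)) * W)) 0 (Pi.single e 1) -
        fderiv ℝ (fun θ : (Edge d L → ℝ) => S ((fun i : Edge d L => Circle.exp (ε * θ i)) * W')) 0 (Pi.single e 1)| ≤ K * dist W W')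
    (q : GaugeConfig d L Circle) (p : Edge d L → ℝ) :
    let D : GaugeConfig d L Circle → Edge d L → ℝ := fun W e =>
      fderiv ℝ (fun θ : (Edge d L → ℝ) => S ((fun i : Edge d L => Circle.exp (ε * θ i)) * W)) 0 (Pi.single e 1)
    let g : GaugeConfig d L Circle → Edge d L → ℝ := fun W e => -(1 / (4 * κ)) * D W e
    let p₁ : Edge d L → ℝ := p + g q
    let q' : GaugeConfig d L Circle := (fun i : Edge d L => Circle.exp (ε * p₁ i)) * q
    |(S q' + u1Kinetic κ (p₁ + g q')) - (S q + u1Kinetic κ p)| ≤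
      K * ‖p₁‖ * |ε| * (∑ e, |p₁ e| + Fintype.card (Edge d L) * Dmax / (8 * κ)) := by
  intro D g p₁ q'
  have hid := u1Leapfrog_energy_identity S ε κ hκ.ne' q p
  simp only at hid
  rw [hid]
  -- the drift moves the field by at most |ε|·‖p₁‖
  have hdist : dist q q' ≤ |ε| * ‖p₁‖ := by
    have h := dist_u1Drift_le ε q p₁ 1 0
    have h0 : (fun i : Edge d L => Circle.exp (ε * ((0 : ℝ) • p₁) i)) * q = q := by
      funext i
      simp only [Pi.mul_apply, Pi.smul_apply, smul_eq_mul, zero_mul, mul_zero, Circle.exp_zero, one_mul]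
    rw [h0, one_smul, sub_zero, abs_one, mul_one, dist_comm] at h
    exact h
  have hg : ∀ W e, g W e = -(1 / (4 * κ)) * D W e := fun W e => rfl
  -- term 1: ½ Σ p₁ (D q − D q')
  have h1 : |(1 / 2) * ∑ e, p₁ e * (D q e - D q' e)| ≤ (1 / 2) * (K * ‖p₁‖ * |ε| * ∑ e, |p₁ e|) := by
    rw [abs_mul, abs_of_pos (by norm_num : (0 : ℝ) < 1 / 2)]
    refine mul_le_mul_of_nonneg_left ?_ (by norm_num)
    refine (Finset.abs_sum_le_sum_abs _ _).trans ?_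
    rw [Finset.mul_sum]
    refine Finset.sum_le_sum fun e _ => ?_
    rw [abs_mul]
    have hde : |D q e - D q' e| ≤ K * (|ε| * ‖p₁‖) := (hDK q q' e).trans (mul_le_mul_of_nonneg_left hdist hK0)
    calc |p₁ e| * |D q e - D q' e| ≤ |p₁ e| * (K * (|ε| * ‖p₁‖)) := mul_le_mul_of_nonneg_left hde (abs_nonneg _)
      _ = K * ‖p₁‖ * |ε| * |p₁ e| := by ring
  -- term 2: the Taylor remainder of the potential (U1ExactForceWork §3 with κ_W = 1, c = ε)
  have h2 : |S q' - S q - ∑ e, D q e * p₁ e| ≤ |ε| * K * ‖p₁‖ * (∑ e, |p₁ e|) / 2 := by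
    have h := abs_action_u1Drift_sub_linear_le S ε 1 hd hK0
      (fun W W' e => by simpa only [one_mul] using hDK W W' e) q p₁
    simpa only [one_mul] using h
  -- term 3: κ Σ (g(q')² − g(q)²)
  have h3 : |κ * ∑ e, ((g q' e) ^ 2 - (g q e) ^ 2)| ≤ Fintype.card (Edge d L) * (K * ‖p₁‖ * |ε| * Dmax / (8 * κ)) := by
    rw [abs_mul, abs_of_pos hκ]
    have hge : ∀ e, |(g q' e) ^ 2 - (g q e) ^ 2| ≤ K * ‖p₁‖ * |ε| * Dmax / (8 * κ ^ 2) := by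
      intro e
      rw [sq_sub_sq, abs_mul]
      have hq : (0 : ℝ) < 1 / (4 * κ) := by positivity
      have hsum : |g q' e + g q e| ≤ 2 * Dmax / (4 * κ) := by
        calc |g q' e + g q e| ≤ |g q' e| + |g q e| := abs_add_le _ _
          _ = (1 / (4 * κ)) * |D q' e| + (1 / (4 * κ)) * |D q e| := by
              rw [hg, hg, abs_mul, abs_mul, abs_neg, abs_of_pos hq]
          _ ≤ (1 / (4 * κ)) * Dmax + (1 / (4 * κ)) * Dmax := by gcongr <;> exact hDb _ e
          _ = 2 * Dmax / (4 * κ) := by ring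
      have hdiff : |g q' e - g q e| ≤ K * (|ε| * ‖p₁‖) / (4 * κ) := by
        have hc : |D q' e - D q e| ≤ K * (|ε| * ‖p₁‖) :=
          (hDK q' q e).trans (mul_le_mul_of_nonneg_left (by rw [dist_comm]; exact hdist) hK0)
        calc |g q' e - g q e| = (1 / (4 * κ)) * |D q' e - D q e| := by
              rw [hg, hg, ← mul_sub, abs_mul, abs_neg, abs_of_pos hq]
          _ ≤ (1 / (4 * κ)) * (K * (|ε| * ‖p₁‖)) := by gcongr
          _ = K * (|ε| * ‖p₁‖) / (4 * κ) := by ring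
      have L1 : ∀ P : ℝ, (2 * Dmax / (4 * κ)) * (K * (|ε| * P) / (4 * κ)) = K * P * |ε| * Dmax / (8 * κ ^ 2) := by
        intro P; field_simp; ring
      calc |g q' e + g q e| * |g q' e - g q e| ≤ (2 * Dmax / (4 * κ)) * (K * (|ε| * ‖p₁‖) / (4 * κ)) :=
            mul_le_mul hsum hdiff (abs_nonneg _) (by positivity)
        _ = K * ‖p₁‖ * |ε| * Dmax / (8 * κ ^ 2) := L1 _
    calc κ * |∑ e, ((g q' e) ^ 2 - (g q e) ^ 2)| ≤ κ * ∑ e, |(g q' e) ^ 2 - (g q e) ^ 2| :=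
          mul_le_mul_of_nonneg_left (Finset.abs_sum_le_sum_abs _ _) hκ.le
      _ ≤ κ * ∑ _e : Edge d L, K * ‖p₁‖ * |ε| * Dmax / (8 * κ ^ 2) :=
          mul_le_mul_of_nonneg_left (Finset.sum_le_sum fun e _ => hge e) hκ.le
      _ = Fintype.card (Edge d L) * (K * ‖p₁‖ * |ε| * Dmax / (8 * κ)) := by
          have L2 : ∀ n P : ℝ, κ * (n * (K * P * |ε| * Dmax / (8 * κ ^ 2))) = n * (K * P * |ε| * Dmax / (8 * κ)) := by
            intro n P; field_simp
          rw [Finset.sum_const, Finset.card_univ, nsmul_eq_mul]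
          exact L2 _ _
  -- assemble
  calc |(1 / 2) * ∑ e, p₁ e * (D q e - D q' e) + (S q' - S q - ∑ e, D q e * p₁ e) + κ * ∑ e, ((g q' e) ^ 2 - (g q e) ^ 2)|
      ≤ |(1 / 2) * ∑ e, p₁ e * (D q e - D q' e)| + |S q' - S q - ∑ e, D q e * p₁ e| + |κ * ∑ e, ((g q' e) ^ 2 - (g q e) ^ 2)| :=
        abs_add_three _ _ _
    _ ≤ (1 / 2) * (K * ‖p₁‖ * |ε| * ∑ e, |p₁ e|) + |ε| * K * ‖p₁‖ * (∑ e, |p₁ e|) / 2 +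
          Fintype.card (Edge d L) * (K * ‖p₁‖ * |ε| * Dmax / (8 * κ)) := add_le_add (add_le_add h1 h2) h3
    _ = K * ‖p₁‖ * |ε| * (∑ e, |p₁ e| + Fintype.card (Edge d L) * Dmax / (8 * κ)) := by ring

end Energy

/-! ## §3 The whole trajectory: `n` steps, momentum growth, and the energy error of the engine's proposal -/

section Trajectory

variable [NeZero L]

/-- The consistent half kick is bounded by `D_max/(4κ)` in the sup norm. -/
theorem norm_u1HalfKick_le (S : GaugeConfig d L Circle → ℝ) (ε κ : ℝ) (hκ : 0 < κ) {Dmax : ℝ} (hD0 : 0 ≤ Dmax)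
    (hDb : ∀ (W : GaugeConfig d L Circle) (e : Edge d L), |fderiv ℝ (fun θ : (Edge d L → ℝ) => S ((fun i : Edge d L => Circle.exp (ε * θ i)) * W)) 0 (Pi.single e 1)| ≤ Dmax) (W : GaugeConfig d L Circle) :
    ‖(fun (W : GaugeConfig d L Circle) (e : Edge d L) => -(1 / (4 * κ)) * fderiv ℝ (fun θ : (Edge d L → ℝ) => S ((fun i : Edge d L => Circle.exp (ε * θ i)) * W)) 0 (Pi.single e 1)) W‖ ≤ Dmax / (4 * κ) := by
  refine (pi_norm_le_iff_of_nonneg (by positivity)).2 fun e => ?_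
  rw [Real.norm_eq_abs]
  simp only [abs_mul, abs_neg, abs_of_pos (by positivity : (0 : ℝ) < 1 / (4 * κ))]
  calc 1 / (4 * κ) * |fderiv ℝ (fun θ : (Edge d L → ℝ) => S ((fun i : Edge d L => Circle.exp (ε * θ i)) * W)) 0 (Pi.single e 1)| ≤ 1 / (4 * κ) * Dmax := by gcongr; exact hDb W e
    _ = Dmax / (4 * κ) := by ring

/-- **Momentum growth along the trajectory**: after `k` steps the sup norm of the momentum has grown by at
most `2k·D_max/(4κ)` and its `ℓ¹` norm by at most `2k·|E|·D_max/(4κ)`. -/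
theorem u1LeapfrogStep_iterate_snd_le (S : GaugeConfig d L Circle → ℝ) (ε κ : ℝ) (hκ : 0 < κ) {Dmax : ℝ} (hD0 : 0 ≤ Dmax)
    (hDb : ∀ (W : GaugeConfig d L Circle) (e : Edge d L), |fderiv ℝ (fun θ : (Edge d L → ℝ) => S ((fun i : Edge d L => Circle.exp (ε * θ i)) * W)) 0 (Pi.single e 1)| ≤ Dmax)
    (q : GaugeConfig d L Circle) (p : Edge d L → ℝ) (k : ℕ) :
    ‖((⇑(palindromicWord [kick (fun (W : GaugeConfig d L Circle) (e : Edge d L) => -(1 / (4 * κ)) * fderiv ℝ (fun θ : (Edge d L → ℝ) => S ((fun i : Edge d L => Circle.exp (ε * θ i)) * W)) 0 (Pi.single e 1))] (drift (mulDrift (u1ExpDrift ε)))))^[k] (q, p)).2‖ ≤ ‖p‖ + 2 * k * (Dmax / (4 * κ)) ∧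
      ∑ e, |((⇑(palindromicWord [kick (fun (W : GaugeConfig d L Circle) (e : Edge d L) => -(1 / (4 * κ)) * fderiv ℝ (fun θ : (Edge d L → ℝ) => S ((fun i : Edge d L => Circle.exp (ε * θ i)) * W)) 0 (Pi.single e 1))] (drift (mulDrift (u1ExpDrift ε)))))^[k] (q, p)).2 e| ≤ ∑ e, |p e| + 2 * k * (Fintype.card (Edge d L) * (Dmax / (4 * κ))) := by
  have hg := norm_u1HalfKick_le S ε κ hκ hD0 hDb
  have hge : ∀ (W : GaugeConfig d L Circle) (e : Edge d L), |(fun (W : GaugeConfig d L Circle) (e : Edge d L) => -(1 / (4 * κ)) * fderiv ℝ (fun θ : (Edge d L → ℝ) => S ((fun i : Edge d L => Circle.exp (ε * θ i)) * W)) 0 (Pi.single e 1)) W e| ≤ Dmax / (4 * κ) := fun W e => by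
    have h := (norm_le_pi_norm ((fun (W : GaugeConfig d L Circle) (e : Edge d L) => -(1 / (4 * κ)) * fderiv ℝ (fun θ : (Edge d L → ℝ) => S ((fun i : Edge d L => Circle.exp (ε * θ i)) * W)) 0 (Pi.single e 1)) W) e).trans (hg W)
    rwa [Real.norm_eq_abs] at h
  induction k with
  | zero => simp
  | succ k ih =>
    rw [Function.iterate_succ_apply']
    set z := (⇑(palindromicWord [kick (fun (W : GaugeConfig d L Circle) (e : Edge d L) => -(1 / (4 * κ)) * fderiv ℝ (fun θ : (Edge d L → ℝ) => S ((fun i : Edge d L => Circle.exp (ε * θ i)) * W)) 0 (Pi.single e 1))] (drift (mulDrift (u1ExpDrift ε)))))^[k] (q, p) with hz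
    obtain ⟨ih1, ih2⟩ := ih
    have hstep := u1LeapfrogStep_apply (fun (W : GaugeConfig d L Circle) (e : Edge d L) => -(1 / (4 * κ)) * fderiv ℝ (fun θ : (Edge d L → ℝ) => S ((fun i : Edge d L => Circle.exp (ε * θ i)) * W)) 0 (Pi.single e 1)) ε z.1 z.2
    rw [Prod.mk.eta] at hstep
    rw [hstep]
    constructor
    · calc ‖z.2 + (fun (W : GaugeConfig d L Circle) (e : Edge d L) => -(1 / (4 * κ)) * fderiv ℝ (fun θ : (Edge d L → ℝ) => S ((fun i : Edge d L => Circle.exp (ε * θ i)) * W)) 0 (Pi.single e 1)) z.1 + (fun (W : GaugeConfig d L Circle) (e : Edge d L) => -(1 / (4 * κ)) * fderiv ℝ (fun θ : (Edge d L → ℝ) => S ((fun i : Edge d L => Circle.exp (ε * θ i)) * W)) 0 (Pi.single e 1)) ((fun i : Edge d L => Circle.exp (ε * (z.2 + (fun (W : GaugeConfig d L Circle) (e : Edge d L) => -(1 / (4 * κ)) * fderiv ℝ (fun θ : (Edge d L → ℝ) => S ((fun i : Edge d L => Circle.exp (ε * θ i)) * W)) 0 (Pi.single e 1)) z.1) i))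 * z.1)‖
          ≤ ‖z.2‖ + ‖(fun (W : GaugeConfig d L Circle) (e : Edge d L) => -(1 / (4 * κ)) * fderiv ℝ (fun θ : (Edge d L → ℝ) => S ((fun i : Edge d L => Circle.exp (ε * θ i)) * W)) 0 (Pi.single e 1)) z.1‖ + ‖(fun (W : GaugeConfig d L Circle) (e : Edge d L) => -(1 / (4 * κ)) * fderiv ℝ (fun θ : (Edge d L → ℝ) => S ((fun i : Edge d L => Circle.exp (ε * θ i)) * W)) 0 (Pi.single e 1)) ((fun i : Edge d L => Circle.exp (ε * (z.2 + (fun (W : GaugeConfig d L Circle) (e : Edge d L) => -(1 / (4 * κ)) * fderiv ℝ (fun θ : (Edge d L → ℝ) => S ((fun i : Edge d L => Circle.exp (ε * θ i)) * W)) 0 (Pi.single e 1)) z.1) i)) * z.1)‖ :=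
            (norm_add_le _ _).trans (add_le_add (norm_add_le _ _) le_rfl)
        _ ≤ (‖p‖ + 2 * k * (Dmax / (4 * κ))) + Dmax / (4 * κ) + Dmax / (4 * κ) := add_le_add (add_le_add ih1 (hg _)) (hg _)
        _ = ‖p‖ + 2 * ((k + 1 : ℕ) : ℝ) * (Dmax / (4 * κ)) := by push_cast; ring
    · calc ∑ e, |(z.2 + (fun (W : GaugeConfig d L Circle) (e : Edge d L) => -(1 / (4 * κ)) * fderiv ℝ (fun θ : (Edge d L → ℝ) => S ((fun i : Edge d L => Circle.exp (ε * θ i)) * W)) 0 (Pi.single e 1)) z.1 + (fun (W : GaugeConfig d L Circle) (e : Edge d L) => -(1 / (4 * κ)) * fderiv ℝ (fun θ : (Edge d L → ℝ) => S ((fun i : Edge d L => Circle.exp (ε * θ i)) * W)) 0 (Pi.single e 1)) ((fun i : Edge d L => Circle.exp (ε * (z.2 + (fun (W : GaugeConfig d L Circle) (e : Edge d L) => -(1 / (4 * κ)) * fderiv ℝ (fun θ : (Edge d L → ℝ) => S ((fun i : Edge d L => Circle.exp (ε * θ i)) * W)) 0 (Pi.single e 1)) z.1) i)) * z.1)) 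e|
          ≤ ∑ e, (|z.2 e| + Dmax / (4 * κ) + Dmax / (4 * κ)) := by
            refine Finset.sum_le_sum fun e _ => ?_
            simp only [Pi.add_apply]
            exact (abs_add_le _ _).trans (add_le_add ((abs_add_le _ _).trans (add_le_add le_rfl (hge _ e))) (hge _ e))
        _ = ∑ e, |z.2 e| + 2 * (Fintype.card (Edge d L) * (Dmax / (4 * κ))) := by
            rw [Finset.sum_add_distrib, Finset.sum_add_distrib, Finset.sum_const, Finset.card_univ, nsmul_eq_mul]; ring
        _ ≤ ∑ e, |p e| + 2 * ((k + 1 : ℕ) : ℝ) * (Fintype.card (Edge d L) * (Dmax / (4 * κ))) := by push_cast; linarith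

/-- **THE ENERGY ERROR OF THE `n`-STEP TRAJECTORY**: for every `k ≤ N`,
`|H(wᵏ(q,p)) − H(q,p)| ≤ k · K·|ε|·(‖p‖ + (2N+1)·D_max/(4κ))·(Σ_e|p_e| + (2N+1)·|E|·D_max/(4κ) + |E|·D_max/(8κ))`
— linear in the number of steps, second order in the step size. -/
theorem abs_u1LeapfrogN_energy_error_le (S : GaugeConfig d L Circle → ℝ) (ε κ : ℝ) (hκ : 0 < κ)
    (hd : ∀ W : GaugeConfig d L Circle, DifferentiableAt ℝ (fun θ : (Edge d L → ℝ) => S ((fun i : Edge d L => Circle.exp (ε * θ i)) * W)) 0)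
    {Dmax K : ℝ} (hD0 : 0 ≤ Dmax) (hK0 : 0 ≤ K)
    (hDb : ∀ (W : GaugeConfig d L Circle) (e : Edge d L), |fderiv ℝ (fun θ : (Edge d L → ℝ) => S ((fun i : Edge d L => Circle.exp (ε * θ i)) * W)) 0 (Pi.single e 1)| ≤ Dmax)
    (hDK : ∀ (W W' : GaugeConfig d L Circle) (e : Edge d L),
      |fderiv ℝ (fun θ : (Edge d L → ℝ) => S ((fun i : Edge d L => Circle.exp (ε * θ i)) * W)) 0 (Pi.single e 1) - fderiv ℝ (fun θ : (Edge d L → ℝ) => S ((fun i : Edge d L => Circle.exp (ε * θ i)) * W')) 0 (Pi.single e 1)| ≤ K * dist W W')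
    (q : GaugeConfig d L Circle) (p : Edge d L → ℝ) (N : ℕ) :
    ∀ k ≤ N, |(S ((⇑(palindromicWord [kick (fun (W : GaugeConfig d L Circle) (e : Edge d L) => -(1 / (4 * κ)) * fderiv ℝ (fun θ : (Edge d L → ℝ) => S ((fun i : Edge d L => Circle.exp (ε * θ i)) * W)) 0 (Pi.single e 1))] (drift (mulDrift (u1ExpDrift ε)))))^[k] (q, p)).1 + u1Kinetic κ ((⇑(palindromicWord [kick (fun (W : GaugeConfig d L Circle) (e : Edge d L) => -(1 / (4 * κ)) * fderiv ℝ (fun θ : (Edge d L → ℝ) => S ((fun i : Edge d L => Circle.exp (ε * θ i)) * W)) 0 (Pi.single e 1))] (drift (mulDrift (u1ExpDrift ε)))))^[k] (q, p)).2) - (S q + u1Kinetic κ p)| ≤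
      k * (K * (‖p‖ + (2 * N + 1) * (Dmax / (4 * κ))) * |ε| *
        ((∑ e, |p e| + (2 * N + 1) * (Fintype.card (Edge d L) * (Dmax / (4 * κ)))) + Fintype.card (Edge d L) * Dmax / (8 * κ))) := by
  have hg := norm_u1HalfKick_le S ε κ hκ hD0 hDb
  have hge : ∀ (W : GaugeConfig d L Circle) (e : Edge d L), |(fun (W : GaugeConfig d L Circle) (e : Edge d L) => -(1 / (4 * κ)) * fderiv ℝ (fun θ : (Edge d L → ℝ) => S ((fun i : Edge d L => Circle.exp (ε * θ i)) * W)) 0 (Pi.single e 1)) W e| ≤ Dmax / (4 * κ) := fun W e => by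
    have h := (norm_le_pi_norm ((fun (W : GaugeConfig d L Circle) (e : Edge d L) => -(1 / (4 * κ)) * fderiv ℝ (fun θ : (Edge d L → ℝ) => S ((fun i : Edge d L => Circle.exp (ε * θ i)) * W)) 0 (Pi.single e 1)) W) e).trans (hg W)
    rwa [Real.norm_eq_abs] at h
  set B := K * (‖p‖ + (2 * N + 1) * (Dmax / (4 * κ))) * |ε| *
        ((∑ e, |p e| + (2 * N + 1) * (Fintype.card (Edge d L) * (Dmax / (4 * κ)))) + Fintype.card (Edge d L) * Dmax / (8 * κ)) with hB
  intro k
  induction k with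
  | zero => intro _; simp
  | succ k ih =>
    intro hk
    have hk' : k ≤ N := Nat.le_of_succ_le hk
    have hkN : (k : ℝ) + 1 ≤ N := by exact_mod_cast hk
    specialize ih hk'
    rw [Function.iterate_succ_apply']
    set z := (⇑(palindromicWord [kick (fun (W : GaugeConfig d L Circle) (e : Edge d L) => -(1 / (4 * κ)) * fderiv ℝ (fun θ : (Edge d L → ℝ) => S ((fun i : Edge d L => Circle.exp (ε * θ i)) * W)) 0 (Pi.single e 1))] (drift (mulDrift (u1ExpDrift ε)))))^[k] (q, p) with hz
    obtain ⟨hz1, hz2⟩ := u1LeapfrogStep_iterate_snd_le S ε κ hκ hD0 hDb q p k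
    rw [← hz] at hz1 hz2
    -- one more step from z
    have hstep := abs_u1Leapfrog_energy_error_le S ε κ hκ hd hD0 hK0 hDb hDK z.1 z.2
    simp only at hstep
    have happ := u1LeapfrogStep_apply (fun (W : GaugeConfig d L Circle) (e : Edge d L) => -(1 / (4 * κ)) * fderiv ℝ (fun θ : (Edge d L → ℝ) => S ((fun i : Edge d L => Circle.exp (ε * θ i)) * W)) 0 (Pi.single e 1)) ε z.1 z.2
    rw [Prod.mk.eta] at happ
    rw [happ]
    simp only
    -- the momentum after the first half kick, and its norms
    have hn1 : ‖z.2 + (fun (W : GaugeConfig d L Circle) (e : Edge d L) => -(1 / (4 * κ)) * fderiv ℝ (fun θ : (Edge d L → ℝ) => S ((fun i : Edge d L => Circle.exp (ε * θ i)) * W)) 0 (Pi.single e 1)) z.1‖ ≤ ‖p‖ + (2 * N + 1) * (Dmax / (4 * κ)) := by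
      calc ‖z.2 + (fun (W : GaugeConfig d L Circle) (e : Edge d L) => -(1 / (4 * κ)) * fderiv ℝ (fun θ : (Edge d L → ℝ) => S ((fun i : Edge d L => Circle.exp (ε * θ i)) * W)) 0 (Pi.single e 1)) z.1‖ ≤ ‖z.2‖ + ‖(fun (W : GaugeConfig d L Circle) (e : Edge d L) => -(1 / (4 * κ)) * fderiv ℝ (fun θ : (Edge d L → ℝ) => S ((fun i : Edge d L => Circle.exp (ε * θ i)) * W)) 0 (Pi.single e 1)) z.1‖ := norm_add_le _ _
        _ ≤ (‖p‖ + 2 * k * (Dmax / (4 * κ))) + Dmax / (4 * κ) := add_le_add hz1 (hg _)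
        _ ≤ ‖p‖ + (2 * N + 1) * (Dmax / (4 * κ)) := by nlinarith [div_nonneg hD0 (by positivity : (0:ℝ) ≤ 4 * κ)]
    have hs1 : ∑ e, |(z.2 + (fun (W : GaugeConfig d L Circle) (e : Edge d L) => -(1 / (4 * κ)) * fderiv ℝ (fun θ : (Edge d L → ℝ) => S ((fun i : Edge d L => Circle.exp (ε * θ i)) * W)) 0 (Pi.single e 1)) z.1) e| ≤ ∑ e, |p e| + (2 * N + 1) * (Fintype.card (Edge d L) * (Dmax / (4 * κ))) := by
      calc ∑ e, |(z.2 + (fun (W : GaugeConfig d L Circle) (e : Edge d L) => -(1 / (4 * κ)) * fderiv ℝ (fun θ : (Edge d L → ℝ) => S ((fun i : Edge d L => Circle.exp (ε * θ i)) * W)) 0 (Pi.single e 1)) z.1) e| ≤ ∑ e, (|z.2 e| + Dmax / (4 * κ)) := by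
            refine Finset.sum_le_sum fun e _ => ?_
            simp only [Pi.add_apply]
            exact (abs_add_le _ _).trans (add_le_add le_rfl (hge _ e))
        _ = ∑ e, |z.2 e| + Fintype.card (Edge d L) * (Dmax / (4 * κ)) := by
            rw [Finset.sum_add_distrib, Finset.sum_const, Finset.card_univ, nsmul_eq_mul]
        _ ≤ ∑ e, |p e| + (2 * N + 1) * (Fintype.card (Edge d L) * (Dmax / (4 * κ))) := by
            nlinarith [hz2, mul_nonneg (Nat.cast_nonneg (Fintype.card (Edge d L))) (div_nonneg hD0 (by positivity : (0:ℝ) ≤ 4 * κ))]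
    have hstep' : |(S ((fun i : Edge d L => Circle.exp (ε * (z.2 + (fun (W : GaugeConfig d L Circle) (e : Edge d L) => -(1 / (4 * κ)) * fderiv ℝ (fun θ : (Edge d L → ℝ) => S ((fun i : Edge d L => Circle.exp (ε * θ i)) * W)) 0 (Pi.single e 1)) z.1) i)) * z.1) +
          u1Kinetic κ (z.2 + (fun (W : GaugeConfig d L Circle) (e : Edge d L) => -(1 / (4 * κ)) * fderiv ℝ (fun θ : (Edge d L → ℝ) => S ((fun i : Edge d L => Circle.exp (ε * θ i)) * W)) 0 (Pi.single e 1)) z.1 + (fun (W : GaugeConfig d L Circle) (e : Edge d L) => -(1 / (4 * κ)) * fderiv ℝ (fun θ : (Edge d L → ℝ) => S ((fun i : Edge d L => Circle.exp (ε * θ i)) * W)) 0 (Pi.single e 1)) ((fun i : Edge d L => Circle.exp (ε * (z.2 + (fun (W : GaugeConfig d L Circle) (e : Edge d L) => -(1 / (4 * κ)) * fderiv ℝ (fun θ : (Edge d L → ℝ) => S ((fun i : Edge d L => Circle.exp (ε * θ i)) * W)) 0 (Pi.single e 1)) z.1) i)) * z.1))) -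
        (S z.1 + u1Kinetic κ z.2)| ≤ B := by
      refine hstep.trans ?_
      rw [hB]
      have hc0 : 0 ≤ Fintype.card (Edge d L) * Dmax / (8 * κ) := by positivity
      have hsum0 : 0 ≤ ∑ e, |(z.2 + (fun (W : GaugeConfig d L Circle) (e : Edge d L) => -(1 / (4 * κ)) * fderiv ℝ (fun θ : (Edge d L → ℝ) => S ((fun i : Edge d L => Circle.exp (ε * θ i)) * W)) 0 (Pi.single e 1)) z.1) e| := Finset.sum_nonneg fun e _ => abs_nonneg _
      gcongr
    -- telescope
    calc |(S ((fun i : Edge d L => Circle.exp (ε * (z.2 + (fun (W : GaugeConfig d L Circle) (e : Edge d L) => -(1 / (4 * κ)) * fderiv ℝ (fun θ : (Edge d L → ℝ) => S ((fun i : Edge d L => Circle.exp (ε * θ i)) * W)) 0 (Pi.single e 1)) z.1) i)) * z.1) +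
            u1Kinetic κ (z.2 + (fun (W : GaugeConfig d L Circle) (e : Edge d L) => -(1 / (4 * κ)) * fderiv ℝ (fun θ : (Edge d L → ℝ) => S ((fun i : Edge d L => Circle.exp (ε * θ i)) * W)) 0 (Pi.single e 1)) z.1 + (fun (W : GaugeConfig d L Circle) (e : Edge d L) => -(1 / (4 * κ)) * fderiv ℝ (fun θ : (Edge d L → ℝ) => S ((fun i : Edge d L => Circle.exp (ε * θ i)) * W)) 0 (Pi.single e 1)) ((fun i : Edge d L => Circle.exp (ε * (z.2 + (fun (W : GaugeConfig d L Circle) (e : Edge d L) => -(1 / (4 * κ)) * fderiv ℝ (fun θ : (Edge d L → ℝ) => S ((fun i : Edge d L => Circle.exp (ε * θ i)) * W)) 0 (Pi.single e 1)) z.1) i)) * z.1))) -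
          (S q + u1Kinetic κ p)|
        ≤ |(S ((fun i : Edge d L => Circle.exp (ε * (z.2 + (fun (W : GaugeConfig d L Circle) (e : Edge d L) => -(1 / (4 * κ)) * fderiv ℝ (fun θ : (Edge d L → ℝ) => S ((fun i : Edge d L => Circle.exp (ε * θ i)) * W)) 0 (Pi.single e 1)) z.1) i)) * z.1) +
              u1Kinetic κ (z.2 + (fun (W : GaugeConfig d L Circle) (e : Edge d L) => -(1 / (4 * κ)) * fderiv ℝ (fun θ : (Edge d L → ℝ) => S ((fun i : Edge d L => Circle.exp (ε * θ i)) * W)) 0 (Pi.single e 1)) z.1 + (fun (W : GaugeConfig d L Circle) (e : Edge d L) => -(1 / (4 * κ)) * fderiv ℝ (fun θ : (Edge d L → ℝ) => S ((fun i : Edge d L => Circle.exp (ε * θ i)) * W)) 0 (Pi.single e 1)) ((fun i : Edge d L => Circle.exp (ε * (z.2 + (fun (W : GaugeConfig d L Circle) (e : Edge d L) => -(1 / (4 * κ)) * fderiv ℝ (fun θ : (Edge d L → ℝ) => S ((fun i : Edge d L => Circle.exp (ε * θ i)) * W)) 0 (Pi.single e 1)) z.1) i)) * z.1))) -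
            (S z.1 + u1Kinetic κ z.2)| + |(S z.1 + u1Kinetic κ z.2) - (S q + u1Kinetic κ p)| := abs_sub_le _ _ _
      _ ≤ B + k * B := add_le_add hstep' ih
      _ = ((k + 1 : ℕ) : ℝ) * B := by push_cast; ring

/-- **THE ENERGY ERROR OF THE ENGINE'S `n`-STEP PROPOSAL** `u1LeapfrogProposalN ε g n = flip ∘ (kick–drift–kick)ⁿ`
with the consistent half kick — the quantity in the Metropolis test of `u1LeapfrogHMCN`:
`|H(Ψ_n(q,p)) − H(q,p)| ≤ n · K·|ε|·(‖p‖ + (2n+1)·D_max/(4κ))·(Σ_e|p_e| + (2n+1)·|E|·D_max/(4κ) + |E|·D_max/(8κ))`.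
Hence the acceptance probability of the proposal is at least `exp(−that)`: with `K, D_max = O(ε)` the bound
is `O(n ε²) = O(τ ε)` at fixed trajectory length `τ = nε`. -/
theorem abs_u1LeapfrogProposalN_energy_error_le (S : GaugeConfig d L Circle → ℝ) (ε κ : ℝ) (hκ : 0 < κ)
    (hd : ∀ W : GaugeConfig d L Circle, DifferentiableAt ℝ (fun θ : (Edge d L → ℝ) => S ((fun i : Edge d L => Circle.exp (ε * θ i)) * W)) 0)
    {Dmax K : ℝ} (hD0 : 0 ≤ Dmax) (hK0 : 0 ≤ K)
    (hDb : ∀ (W : GaugeConfig d L Circle) (e : Edge d L), |fderiv ℝ (fun θ : (Edge d L → ℝ) => S ((fun i : Edge d L => Circle.exp (ε * θ i)) * W)) 0 (Pi.single e 1)| ≤ Dmax)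
    (hDK : ∀ (W W' : GaugeConfig d L Circle) (e : Edge d L),
      |fderiv ℝ (fun θ : (Edge d L → ℝ) => S ((fun i : Edge d L => Circle.exp (ε * θ i)) * W)) 0 (Pi.single e 1) - fderiv ℝ (fun θ : (Edge d L → ℝ) => S ((fun i : Edge d L => Circle.exp (ε * θ i)) * W')) 0 (Pi.single e 1)| ≤ K * dist W W')
    (q : GaugeConfig d L Circle) (p : Edge d L → ℝ) (n : ℕ) :
    |(S (u1LeapfrogProposalN ε (fun (W : GaugeConfig d L Circle) (e : Edge d L) => -(1 / (4 * κ)) * fderiv ℝ (fun θ : (Edge d L → ℝ) => S ((fun i : Edge d L => Circle.exp (ε * θ i)) * W)) 0 (Pi.single e 1)) n (q, p)).1 + u1Kinetic κ (u1LeapfrogProposalN ε (fun (W : GaugeConfig d L Circle) (e : Edge d L) => -(1 / (4 * κ)) * fderiv ℝ (fun θ : (Edge d L → ℝ) => S ((fun i : Edge d L => Circle.exp (ε * θ i)) * W)) 0 (Pi.single e 1)) n (q, p)).2) - (S q + u1Kinetic κ p)| ≤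
      n * (K * (‖p‖ + (2 * n + 1) * (Dmax / (4 * κ))) * |ε| *
        ((∑ e, |p e| + (2 * n + 1) * (Fintype.card (Edge d L) * (Dmax / (4 * κ)))) + Fintype.card (Edge d L) * Dmax / (8 * κ))) := by
  have h := abs_u1LeapfrogN_energy_error_le S ε κ hκ hd hD0 hK0 hDb hDK q p n n le_rfl
  rw [u1LeapfrogProposalN, Equiv.Perm.coe_mul, Function.comp_apply, flip_apply, Equiv.Perm.coe_pow]
  simp only [u1Kinetic_neg]
  exact h

end Trajectory

end Summit.Ventures.LatticeQCDFlow.Exactness
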